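import Literature.NumberTheory.Automorphic.UnitaryGroupRayJacquetCriterion           -- ★ `diag_conj_mem_of_mem`, `exists_mem_rayLevel`, `weylLongU_mem_comap_glInt`, …
import Literature.NumberTheory.Automorphic.UnitaryGroupRankOneBigCell               -- ★ `weylLongU_mul_weylLongU`, `coe_coe_weylLongU_three`
import Literature.NumberTheory.Automorphic.BigBruhatCellChart                       -- ★ `weylLong_conj_apply`
import Literature.NumberTheory.Automorphic.UnitaryGroupCongruenceIwahoriFactorisation  -- ★ `exists_unitriangular_mul_lower_of_mem_unitary_congruenceGL`, `isCompact_isOpen_comap_congruenceGL`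
import Literature.NumberTheory.Automorphic.CongruenceSubgroupExpansionGL             -- ★ `conj_mem_congruenceGL` (`K_γ ⊴ GL₃(𝒪)`)
import Literature.NumberTheory.Automorphic.JacquetNonzeroEmbedsNormalizedInd          -- ★ `torusU_mul_comm`
import HarnessLib

/-!
# An Iwahori datum for the Borel subgroup of the quasi-split `U(σ, Φ₃)(K)` along a diagonal ray, with dominance, exhaustion and
# normality in `U ∩ GL₃(𝒪)` (Casselman 1995, Prop. 1.4.4; rank-one kit R5a)

Topic `NumberTheory/Automorphic`; namespace `Literature.NumberTheory.Automorphic.UnitaryGroup`.  ONE DEFINITION WITH BODY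
(`UnitaryGroup.iwahoriDatumU3`) + theorems; no named fact, no instance, no notation, no `sorry`.  Cell `hodgecm-mathlib`, F0∕P3, seat F0P3-p01 (g10):
file (R5a) of the rank-one road to ★ `UnitaryGroup.U3SquareIntegrableExponents` [Casselman1995, Thm. 4.4.6] — the ★ `ParabolicTriple.IwahoriDatum`
that ★ Jacquet's lemma (`JacquetLemma`), ★ R2 `JacquetRayFitting` and ★ R2b `JacquetRayExponents` consume, for the one-place model
`U = U(σ, Φ₃)(K)` (`K` a non-archimedean local field, `σ` a continuous involution), together with the «dominance» hypotheses of ★ R1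
`JacquetRayHeckeOperator` ∕ ★ R4 `CasselmanCriterionRankOne` (`a (K ∩ N) a⁻¹ ⊆ K`, `a⁻¹ (K ∩ N̄) a ⊆ K ∩ N̄`, `⋃ₘ a⁻ᵐ (K ∩ N) aᵐ = N` in the
monotone form, `K_j ⊴ K₀ = U ∩ GL₃(𝒪)`).

THE DATUM.  `t = (B, T, N)` = ★ `borelTriple σ J hJ` (`J = Φ₃`); levels `K_j := U ∩ K_{γ₀^{j+1}}` (principal congruence subgroups ★
`congruenceGL 3 γ`, `0 ≠ γ₀ < 1` a parameter); opposite radical `N̄ := w₀ N w₀` (the `w₀`-conjugate of `N`, `w₀ = weylLongU`, lower unitriangular);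
ray `a := t = diag(w) ∈ U` with `|w_i / w_j| ≤ q < 1` for `i < j` (e.g. `d(ϖ, 1, (σϖ)⁻¹)` for ANY uniformiser `ϖ`, ★
`exists_coe_eq_diagonal_uniformizer`; or Rogawski's `d(ϖ_F, 1, ϖ_F⁻¹)`).  Iwahori factorisation `K_j = (K_j ∩ N̄)(K_j ∩ T)(K_j ∩ N)` in THIS order: from
★ `exists_unitriangular_mul_lower_of_mem_unitary_congruenceGL` applied to `k⁻¹` and the torus splitting of the lower factor read through `w₀` (★
`exists_unipotent_mul_torus_of_mem_borelOfForm`; the diagonal part of an element of `K_γ` lies in `K_γ`).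

RESULTS (hypothesis names as in R1∕R4): `glDiagonal_mem_congruenceGL_of_apply_eq` · `weylLongU_conj_*` bookkeeping · **`coe_comap_congruenceGL_eq_mul`**
(the factorisation) · `conj_mem_comap_congruenceGL_of_mem_N` (`haN`, any ratio bound `≤ 1`) · `inv_conj_mem_of_mem_Nbar` (`haNbar`, level `q γ`) ·
`pow_conj_mem_of_mem_N` · **`exists_forall_pow_conj_mem`** (`hexh`) · `exists_pow_inv_conj_Nbar_le` · `inv_conj_mem_comap_congruenceGL_of_mem_glInt` (`hKK₀`)
· **`iwahoriDatumU3`** and its field lemmas `iwahoriDatumU3_K ∕ _a ∕ _Nbar`.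

## References
* [Casselman1995] W. Casselman, *Introduction to the theory of admissible representations of `p`-adic reductive groups* (draft 1 May 1995),
  Prop. 1.4.3, Prop. 1.4.4 (Iwahori factorisation), Thm. 3.3.3, Thm. 4.4.6.
* [BernsteinZelevinsky1976] I. N. Bernstein, A. V. Zelevinsky, Russian Math. Surveys 31:3 (1976), §3.13–3.21.
* [Rogawski1990] J. D. Rogawski, *Automorphic Representations of Unitary Groups in Three Variables*, §1.10 p. 9, §12.2 p. 173.
* [BruhatTits1972] F. Bruhat, J. Tits, *Groupes réductifs sur un corps local I*, (4.4.3)–(4.4.4).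
-/

set_option autoImplicit false

open scoped MatrixGroups Pointwise Topology
open ValuativeRel Matrix

namespace Literature.NumberTheory.Automorphic

namespace UnitaryGroup

/-! ## §1 Algebra over a field with a valuation -/

section Alg

variable {K : Type*} [Field K] [ValuativeRel K] (σ : K →+* K) {J : Matrix (Fin 3) (Fin 3) K}
  (hJ : J = (StdForm.antidiagonal 3).over K)

omit σ in
/-- **The diagonal part of an element of `K_γ` (`γ < 1`) lies in `K_γ`**: `|g_{ii} - 1| ≤ γ < 1` forces `|g_{ii}| = 1`, so `diag(g_{ii})` and its
inverse are integral and `≡ 1 (mod γ)`. [cite: Casselman1995, Prop. 1.4.4] -/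
theorem glDiagonal_mem_congruenceGL_of_apply_eq {γ : ValueGroupWithZero K} (hγ : γ < 1) {g : GL (Fin 3) K} (hg : g ∈ congruenceGL 3 γ)
    (d : Fin 3 → Kˣ) (hd : ∀ i, (d i : K) = (g : Matrix (Fin 3) (Fin 3) K) i i) : glDiagonal 3 K d ∈ congruenceGL 3 γ := by
  obtain ⟨⟨h1, -⟩, h2, -⟩ := mem_congruenceGL_iff.1 hg
  have hsub : ∀ i, valuation K ((d i : K) - 1) ≤ γ := fun i => by
    have := h2 i i
    rwa [Matrix.sub_apply, Matrix.one_apply_eq, ← hd i] at this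
  have hone : ∀ i, valuation K (d i : K) = 1 := fun i => by
    have h : (d i : K) = 1 + ((d i : K) - 1) := by ring
    rw [h, Valuation.map_add_eq_of_lt_left] <;> rw [Valuation.map_one]
    exact lt_of_le_of_lt (hsub i) hγ
  have hinv : ∀ i, valuation K ((d i : K)⁻¹ - 1) ≤ γ := fun i => by
    have h : ((d i : K))⁻¹ - 1 = (d i : K)⁻¹ * (1 - (d i : K)) := by
      rw [mul_sub, mul_one, inv_mul_cancel₀ (d i).ne_zero]
    rw [h, Valuation.map_mul, map_inv₀, hone i, inv_one, one_mul, Valuation.map_sub_swap]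
    exact hsub i
  refine mem_congruenceGL_iff.2 ⟨⟨fun i j => ?_, fun i j => ?_⟩, fun i j => ?_, fun i j => ?_⟩
  · rw [coe_glDiagonal, Matrix.diagonal_apply]
    split_ifs with h
    · rw [hone]
    · rw [Valuation.map_zero]; exact zero_le
  · rw [← map_inv, coe_glDiagonal, Matrix.diagonal_apply]
    split_ifs with h
    · rw [Pi.inv_apply, Units.val_inv_eq_inv_val, map_inv₀, hone, inv_one]
    · rw [Valuation.map_zero]; exact zero_le
  · rw [coe_glDiagonal, Matrix.sub_apply, Matrix.diagonal_apply, Matrix.one_apply]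
    split_ifs with h
    · exact hsub i
    · rw [sub_zero, Valuation.map_zero]; exact zero_le
  · rw [← map_inv, coe_glDiagonal, Matrix.sub_apply, Matrix.diagonal_apply, Matrix.one_apply]
    split_ifs with h
    · rw [Pi.inv_apply, Units.val_inv_eq_inv_val]; exact hinv i
    · rw [sub_zero, Valuation.map_zero]; exact zero_le

omit [ValuativeRel K] in
/-- The matrix of `w₀ x w₀` (inside `U`): `(w₀ x w₀)_{ij} = x_{rev i, rev j}`. [cite: Rogawski1990, §1.10 p. 9] -/
theorem coe_weylLongU_mul_mul_weylLongU_apply (x : ↥(unitaryGroupOfForm σ J)) (i j : Fin 3) :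
    (((weylLongU σ hJ * x * weylLongU σ hJ : ↥(unitaryGroupOfForm σ J)) : GL (Fin 3) K) : Matrix (Fin 3) (Fin 3) K) i j =
      (((x : ↥(unitaryGroupOfForm σ J)) : GL (Fin 3) K) : Matrix (Fin 3) (Fin 3) K) i.rev j.rev := by
  rw [Subgroup.coe_mul, Subgroup.coe_mul, Units.val_mul, Units.val_mul, coe_weylLongU, weylLong_conj_apply]

omit [ValuativeRel K] in
/-- `w₀ diag(w) w₀ = diag(w ∘ rev)` inside `U`. [cite: Rogawski1990, §1.10 p. 9] -/
theorem coe_weylLongU_mul_mul_weylLongU_of_eq_glDiagonal {x : ↥(unitaryGroupOfForm σ J)} {w : Fin 3 → Kˣ}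
    (hx : ((x : ↥(unitaryGroupOfForm σ J)) : GL (Fin 3) K) = glDiagonal 3 K w) :
    ((weylLongU σ hJ * x * weylLongU σ hJ : ↥(unitaryGroupOfForm σ J)) : GL (Fin 3) K) = glDiagonal 3 K (w ∘ Fin.rev) := by
  apply Units.ext
  ext i j
  rw [coe_weylLongU_mul_mul_weylLongU_apply, hx, coe_glDiagonal, coe_glDiagonal, Matrix.diagonal_apply, Matrix.diagonal_apply]
  simp only [Function.comp_apply, Fin.rev_inj]

/-- `w₀ x w₀ ∈ K_γ ∩ U` for `x ∈ K_γ ∩ U` (`w₀ ∈ GL₃(𝒪)` normalises `K_γ`, `w₀⁻¹ = w₀`). [cite: Casselman1995, Prop. 1.4.4] -/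
theorem weylLongU_mul_mul_weylLongU_mem_comap_congruenceGL {γ : ValueGroupWithZero K} {x : ↥(unitaryGroupOfForm σ J)}
    (hx : x ∈ (congruenceGL 3 γ).comap (unitaryGroupOfForm σ J).subtype) :
    weylLongU σ hJ * x * weylLongU σ hJ ∈ (congruenceGL 3 γ).comap (unitaryGroupOfForm σ J).subtype := by
  have hw : weylLongU σ hJ = (weylLongU σ hJ)⁻¹ := eq_inv_of_mul_eq_one_left (weylLongU_mul_weylLongU σ hJ)
  have hre : weylLongU σ hJ * x * weylLongU σ hJ = weylLongU σ hJ * x * (weylLongU σ hJ)⁻¹ := by rw [← hw]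
  rw [hre]
  rw [Subgroup.mem_comap] at hx ⊢
  rw [Subgroup.coe_subtype, Subgroup.coe_mul, Subgroup.coe_mul, Subgroup.coe_inv]
  exact conj_mem_congruenceGL (Subgroup.mem_comap.1 (weylLongU_mem_comap_glInt σ hJ)) hx

/-- `k⁻¹ κ k ∈ K_γ ∩ U` for `k ∈ K₀ = U ∩ GL₃(𝒪)`, `κ ∈ K_γ ∩ U`: the levels are NORMALISED by `K₀` (R4's `hKK₀`). [cite: Casselman1995, Prop. 1.4.4] -/
theorem inv_mul_mul_mem_comap_congruenceGL_of_mem_glInt {γ : ValueGroupWithZero K} {k κ : ↥(unitaryGroupOfForm σ J)}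
    (hk : k ∈ (glInt 3 K).comap (unitaryGroupOfForm σ J).subtype) (hκ : κ ∈ (congruenceGL 3 γ).comap (unitaryGroupOfForm σ J).subtype) :
    k⁻¹ * κ * k ∈ (congruenceGL 3 γ).comap (unitaryGroupOfForm σ J).subtype := by
  rw [Subgroup.mem_comap] at hk hκ ⊢
  rw [Subgroup.coe_subtype, Subgroup.coe_mul, Subgroup.coe_mul, Subgroup.coe_inv]
  have h := conj_mem_congruenceGL ((glInt 3 K).inv_mem hk) hκ
  rwa [inv_inv] at h

/-- **Dominance on `N` (R1's `haN`, quantitative)**: conjugation by a diagonal `s = diag(u) ∈ U` with `|u_i/u_j| ≤ q'` (`i < j`) maps `K_γ ∩ N` into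
`K_{γ'} ∩ N` whenever `q' γ ≤ γ' < 1`; in particular (`q' ≤ 1`, `γ' = γ`) `s (K_γ ∩ N) s⁻¹ ⊆ K_γ`.  This is ★ `diag_conj_mem_of_mem`, recorded in the
binder shape of ★ `JacquetRayHeckeOperator`. [cite: Casselman1995, Prop. 1.4.3, Prop. 1.4.4] -/
theorem conj_mem_comap_congruenceGL_of_mem_N {q γ : ValueGroupWithZero K} (hγ : γ < 1) (hq : q ≤ 1) (s : ↥(unitaryGroupOfForm σ J))
    (u : Fin 3 → Kˣ) (hs : ((s : ↥(unitaryGroupOfForm σ J)) : GL (Fin 3) K) = glDiagonal 3 K u)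
    (hu : ∀ i j : Fin 3, i < j → valuation K ((u i : K) * ((u j : K))⁻¹) ≤ q) {x : ↥(unitaryGroupOfForm σ J)}
    (hx : x ∈ (congruenceGL 3 γ).comap (unitaryGroupOfForm σ J).subtype ⊓ (borelTriple σ J hJ).N) :
    s * x * s⁻¹ ∈ (congruenceGL 3 γ).comap (unitaryGroupOfForm σ J).subtype :=
  (Subgroup.mem_inf.1 (diag_conj_mem_of_mem σ hJ hγ ((mul_le_mul' hq le_rfl).trans (one_mul γ).le) s u hs hu hx)).1

/-- **Powers stay dominant on `N`**: `sᵏ (K_γ ∩ N) s⁻ᵏ ⊆ K_γ ∩ N`. [cite: Casselman1995, Prop. 1.4.3] -/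
theorem pow_conj_mem_of_mem_N {q γ : ValueGroupWithZero K} (hγ : γ < 1) (hq : q ≤ 1) (s : ↥(unitaryGroupOfForm σ J))
    (u : Fin 3 → Kˣ) (hs : ((s : ↥(unitaryGroupOfForm σ J)) : GL (Fin 3) K) = glDiagonal 3 K u)
    (hu : ∀ i j : Fin 3, i < j → valuation K ((u i : K) * ((u j : K))⁻¹) ≤ q) (k : ℕ) {x : ↥(unitaryGroupOfForm σ J)}
    (hx : x ∈ (congruenceGL 3 γ).comap (unitaryGroupOfForm σ J).subtype ⊓ (borelTriple σ J hJ).N) :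
    s ^ k * x * (s ^ k)⁻¹ ∈ (congruenceGL 3 γ).comap (unitaryGroupOfForm σ J).subtype ⊓ (borelTriple σ J hJ).N := by
  induction k with
  | zero => simpa using hx
  | succ k ih =>
    have hre : s ^ (k + 1) * x * (s ^ (k + 1))⁻¹ = s * (s ^ k * x * (s ^ k)⁻¹) * s⁻¹ := by rw [pow_succ']; group
    rw [hre]
    exact diag_conj_mem_of_mem σ hJ hγ ((mul_le_mul' hq le_rfl).trans (one_mul γ).le) s u hs hu ih

omit [ValuativeRel K] in
/-- The diagonal element `w₀ s⁻¹ w₀` for `s = diag(u)`: it is `diag(u⁻¹ ∘ rev)` and its ratios above the diagonal are those of `u`. [cite: Rogawski1990, §1.10 p. 9] -/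
theorem weylLongU_inv_weylLongU_eq_glDiagonal {s : ↥(unitaryGroupOfForm σ J)} {u : Fin 3 → Kˣ}
    (hs : ((s : ↥(unitaryGroupOfForm σ J)) : GL (Fin 3) K) = glDiagonal 3 K u) :
    ((weylLongU σ hJ * s⁻¹ * weylLongU σ hJ : ↥(unitaryGroupOfForm σ J)) : GL (Fin 3) K) = glDiagonal 3 K (u⁻¹ ∘ Fin.rev) :=
  coe_weylLongU_mul_mul_weylLongU_of_eq_glDiagonal σ hJ (by rw [Subgroup.coe_inv, hs, map_inv])

omit [ValuativeRel K] in
/-- Ratio bookkeeping: if `|u_i/u_j| ≤ q` for `i < j` then the same holds for `u⁻¹ ∘ rev`. [cite: Casselman1995, Prop. 1.4.3] -/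
theorem ratio_inv_rev_le [ValuativeRel K] {q : ValueGroupWithZero K} (u : Fin 3 → Kˣ)
    (hu : ∀ i j : Fin 3, i < j → valuation K ((u i : K) * ((u j : K))⁻¹) ≤ q) :
    ∀ i j : Fin 3, i < j → valuation K (((u⁻¹ ∘ Fin.rev) i : Kˣ) * ((((u⁻¹ ∘ Fin.rev) j : Kˣ) : K))⁻¹) ≤ q := by
  intro i j hij
  have h := hu j.rev i.rev (Fin.rev_lt_rev.2 hij)
  simp only [Function.comp_apply, Pi.inv_apply, Units.val_inv_eq_inv_val, inv_inv]
  rwa [mul_comm]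

/-- **Dominance on `N̄ = w₀ N w₀` (R1's `haNbar`, quantitative)**: for `s = diag(u)` as above, `s⁻¹ (K_γ ∩ N̄) s ⊆ K_{γ'} ∩ N̄` whenever `q γ ≤ γ' < 1`
(read through `w₀`: `s⁻¹ x s = w₀ (s' n s'⁻¹) w₀` with `s' = w₀ s⁻¹ w₀ = diag(u⁻¹ ∘ rev)`, `x = w₀ n w₀`). [cite: Casselman1995, Prop. 1.4.3, Prop. 1.4.4] -/
theorem inv_conj_mem_of_mem_Nbar {q γ γ' : ValueGroupWithZero K} (hγ' : γ' < 1) (hqγ : q * γ ≤ γ') (s : ↥(unitaryGroupOfForm σ J))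
    (u : Fin 3 → Kˣ) (hs : ((s : ↥(unitaryGroupOfForm σ J)) : GL (Fin 3) K) = glDiagonal 3 K u)
    (hu : ∀ i j : Fin 3, i < j → valuation K ((u i : K) * ((u j : K))⁻¹) ≤ q) {x : ↥(unitaryGroupOfForm σ J)}
    (hx : x ∈ (congruenceGL 3 γ).comap (unitaryGroupOfForm σ J).subtype ⊓
      ((borelTriple σ J hJ).N).map (MulAut.conj (weylLongU σ hJ)).toMonoidHom) :
    s⁻¹ * x * s ∈ (congruenceGL 3 γ').comap (unitaryGroupOfForm σ J).subtype ⊓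
      ((borelTriple σ J hJ).N).map (MulAut.conj (weylLongU σ hJ)).toMonoidHom := by
  obtain ⟨hxK, hxN⟩ := Subgroup.mem_inf.1 hx
  obtain ⟨n, hn, hnx⟩ := Subgroup.mem_map.1 hxN
  have hw1 : weylLongU σ hJ * weylLongU σ hJ = 1 := weylLongU_mul_weylLongU σ hJ
  have hwinv : (weylLongU σ hJ)⁻¹ = weylLongU σ hJ := (eq_inv_of_mul_eq_one_left hw1).symm
  have hnx' : x = weylLongU σ hJ * n * weylLongU σ hJ := by
    rw [← hnx, MulEquiv.coe_toMonoidHom, MulAut.conj_apply, hwinv]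
  -- `n = w₀ x w₀ ∈ K_γ ∩ N`
  have hnK : n ∈ (congruenceGL 3 γ).comap (unitaryGroupOfForm σ J).subtype := by
    have : n = weylLongU σ hJ * x * weylLongU σ hJ := by
      rw [hnx']
      simp only [← mul_assoc, hw1, one_mul]
      rw [mul_assoc, hw1, mul_one]
    rw [this]
    exact weylLongU_mul_mul_weylLongU_mem_comap_congruenceGL σ hJ hxK
  -- `s' = w₀ s⁻¹ w₀` contracts `K_γ ∩ N` into `K_{γ'} ∩ N`
  set s' : ↥(unitaryGroupOfForm σ J) := weylLongU σ hJ * s⁻¹ * weylLongU σ hJ with hs'def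
  have hmem := diag_conj_mem_of_mem σ hJ hγ' hqγ s' (u⁻¹ ∘ Fin.rev) (weylLongU_inv_weylLongU_eq_glDiagonal σ hJ hs)
    (ratio_inv_rev_le u hu) (Subgroup.mem_inf.2 ⟨hnK, hn⟩)
  obtain ⟨hmK, hmN⟩ := Subgroup.mem_inf.1 hmem
  -- `s⁻¹ x s = w₀ (s' n s'⁻¹) w₀`
  have hre : s⁻¹ * x * s = weylLongU σ hJ * (s' * n * s'⁻¹) * weylLongU σ hJ := by
    rw [hnx', hs'def]
    simp only [_root_.mul_inv_rev, hwinv, inv_inv]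
    simp only [← mul_assoc, hw1, one_mul]
    simp only [mul_assoc, hw1, mul_one]
  rw [hre]
  refine Subgroup.mem_inf.2 ⟨weylLongU_mul_mul_weylLongU_mem_comap_congruenceGL σ hJ hmK, Subgroup.mem_map.2 ⟨_, hmN, ?_⟩⟩
  rw [MulEquiv.coe_toMonoidHom, MulAut.conj_apply, hwinv]

/-- **Powers stay dominant on `N̄`, with shrinking level**: `s⁻ᵏ (K_γ ∩ N̄) sᵏ ⊆ K_{qᵏ γ} ∩ N̄`. [cite: Casselman1995, Prop. 1.4.3] -/
theorem pow_inv_conj_mem_of_mem_Nbar {q γ : ValueGroupWithZero K} (hγ : γ < 1) (hq : q ≤ 1) (s : ↥(unitaryGroupOfForm σ J))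
    (u : Fin 3 → Kˣ) (hs : ((s : ↥(unitaryGroupOfForm σ J)) : GL (Fin 3) K) = glDiagonal 3 K u)
    (hu : ∀ i j : Fin 3, i < j → valuation K ((u i : K) * ((u j : K))⁻¹) ≤ q) (k : ℕ) {x : ↥(unitaryGroupOfForm σ J)}
    (hx : x ∈ (congruenceGL 3 γ).comap (unitaryGroupOfForm σ J).subtype ⊓
      ((borelTriple σ J hJ).N).map (MulAut.conj (weylLongU σ hJ)).toMonoidHom) :
    (s ^ k)⁻¹ * x * s ^ k ∈ (congruenceGL 3 (q ^ k * γ)).comap (unitaryGroupOfForm σ J).subtype ⊓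
      ((borelTriple σ J hJ).N).map (MulAut.conj (weylLongU σ hJ)).toMonoidHom := by
  induction k with
  | zero => simpa using hx
  | succ k ih =>
    have hre : (s ^ (k + 1))⁻¹ * x * s ^ (k + 1) = s⁻¹ * ((s ^ k)⁻¹ * x * s ^ k) * s := by rw [pow_succ]; group
    rw [hre]
    have hlt : q ^ (k + 1) * γ < 1 := by
      calc q ^ (k + 1) * γ ≤ 1 * γ := mul_le_mul' (pow_le_one₀ zero_le hq) le_rfl
        _ = γ := one_mul γ
        _ < 1 := hγ
    have heq : q * (q ^ k * γ) ≤ q ^ (k + 1) * γ := by rw [pow_succ']; rw [mul_assoc]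
    exact inv_conj_mem_of_mem_Nbar σ hJ hlt heq s u hs hu ih

/-! ### The Iwahori factorisation `K_γ ∩ U = (K_γ ∩ N̄)(K_γ ∩ T)(K_γ ∩ N)` -/

/-- **The Iwahori factorisation of `K_γ ∩ U` in the order `N̄ · T · N`** (`γ < 1`): every `k ∈ K_γ ∩ U` is `n̄ m n` with `n̄ ∈ K_γ ∩ w₀Nw₀`,
`m ∈ K_γ ∩ T`, `n ∈ K_γ ∩ N`.  Proof: `k⁻¹ = u b` (★ `exists_unitriangular_mul_lower_of_mem_unitary_congruenceGL`), `w₀ b⁻¹ w₀ ∈ B ∩ U ∩ K_γ` splits as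
`u' · diag(d)` (★ `exists_unipotent_mul_torus_of_mem_borelOfForm`) with `diag(d) ∈ K_γ` (`glDiagonal_mem_congruenceGL_of_apply_eq`), and
`k = (w₀u'w₀)(w₀ diag(d) w₀) u⁻¹`. [cite: Casselman1995, Prop. 1.4.4] [cite: BruhatTits1972, (4.4.4)] -/
theorem coe_comap_congruenceGL_eq_mul {γ : ValueGroupWithZero K} (hγ : γ < 1) :
    (((congruenceGL 3 γ).comap (unitaryGroupOfForm σ J).subtype : Subgroup ↥(unitaryGroupOfForm σ J)) : Set ↥(unitaryGroupOfForm σ J)) =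
      (((congruenceGL 3 γ).comap (unitaryGroupOfForm σ J).subtype ⊓
          ((borelTriple σ J hJ).N).map (MulAut.conj (weylLongU σ hJ)).toMonoidHom : Subgroup ↥(unitaryGroupOfForm σ J)) :
            Set ↥(unitaryGroupOfForm σ J)) *
        (((congruenceGL 3 γ).comap (unitaryGroupOfForm σ J).subtype ⊓ (borelTriple σ J hJ).M : Subgroup ↥(unitaryGroupOfForm σ J)) :
            Set ↥(unitaryGroupOfForm σ J)) *
        (((congruenceGL 3 γ).comap (unitaryGroupOfForm σ J).subtype ⊓ (borelTriple σ J hJ).N : Subgroup ↥(unitaryGroupOfForm σ J)) :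
            Set ↥(unitaryGroupOfForm σ J)) := by
  have hw1 : weylLongU σ hJ * weylLongU σ hJ = 1 := weylLongU_mul_weylLongU σ hJ
  have hwinv : (weylLongU σ hJ)⁻¹ = weylLongU σ hJ := (eq_inv_of_mul_eq_one_left hw1).symm
  apply le_antisymm
  · intro k hk
    have hk' : k ∈ (congruenceGL 3 γ).comap (unitaryGroupOfForm σ J).subtype := hk
    -- `k⁻¹ = u b` in `GL₃(K)` with unitary, `K_γ`-small factors
    have hkinvK : ((k⁻¹ : ↥(unitaryGroupOfForm σ J)) : GL (Fin 3) K) ∈ congruenceGL 3 γ :=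
      Subgroup.mem_comap.1 ((Subgroup.inv_mem _ hk'))
    obtain ⟨u, b, huU, hbU, huN, hbB, huK, hbK, hkub⟩ :=
      exists_unitriangular_mul_lower_of_mem_unitary_congruenceGL σ hγ hJ (k⁻¹ : ↥(unitaryGroupOfForm σ J)).2 hkinvK
    -- the pieces as elements of `U`
    obtain ⟨uU, huUeq⟩ : ∃ uU : ↥(unitaryGroupOfForm σ J), uU = ⟨u, huU⟩ := ⟨_, rfl⟩
    obtain ⟨cU, hcUeq⟩ : ∃ cU : ↥(unitaryGroupOfForm σ J), cU = ⟨b, hbU⟩⁻¹ := ⟨_, rfl⟩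
    have hcoe_u : ((uU : ↥(unitaryGroupOfForm σ J)) : GL (Fin 3) K) = u := by rw [huUeq]
    have hcoe_c : ((cU : ↥(unitaryGroupOfForm σ J)) : GL (Fin 3) K) = b⁻¹ := by rw [hcUeq, Subgroup.coe_inv]
    have hk_eq : k = cU * uU⁻¹ := by
      apply Subtype.ext
      have h1 : ((k⁻¹ : ↥(unitaryGroupOfForm σ J)) : GL (Fin 3) K) = u * b := hkub
      rw [Subgroup.coe_inv] at h1
      rw [Subgroup.coe_mul, Subgroup.coe_inv, hcoe_c, hcoe_u, ← inv_inv ((k : ↥(unitaryGroupOfForm σ J)) : GL (Fin 3) K), h1,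
        _root_.mul_inv_rev]
    -- `b' := w₀ c w₀ ∈ B ∩ U ∩ K_γ`
    set b' : ↥(unitaryGroupOfForm σ J) := weylLongU σ hJ * cU * weylLongU σ hJ with hb'def
    have hcK : cU ∈ (congruenceGL 3 γ).comap (unitaryGroupOfForm σ J).subtype := by
      rw [Subgroup.mem_comap, Subgroup.coe_subtype, hcoe_c]
      exact (congruenceGL 3 γ).inv_mem hbK
    have hb'K : b' ∈ (congruenceGL 3 γ).comap (unitaryGroupOfForm σ J).subtype :=
      weylLongU_mul_mul_weylLongU_mem_comap_congruenceGL σ hJ hcK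
    have hb'B : ((b' : ↥(unitaryGroupOfForm σ J)) : GL (Fin 3) K) ∈ borelOfForm σ 3 := by
      rw [← mem_borelU_iff_mem_borelOfForm hJ, mem_borelU_iff]
      intro i j hij
      rw [hb'def, coe_weylLongU_mul_mul_weylLongU_apply, hcoe_c]
      have hlow := (mem_oppositeParabolicGL_iff (c := (_root_.id : Fin 3 → Fin 3)) (b⁻¹ : GL (Fin 3) K)).1
        ((oppositeParabolicGL K _).inv_mem hbB)
      exact hlow i.rev j.rev (by simpa [Fin.rev_lt_rev] using hij)
    obtain ⟨u', hu', d, hdT, hdiag, hb'ud⟩ := exists_unipotent_mul_torus_of_mem_borelOfForm (σ := σ) (N := 3) hb'B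
    -- the torus factor `diag(d)` and the unipotent factor `u'`, inside `U` and `K_γ`
    have hJ' : (StdForm.antidiagonal 3).over K = J := hJ.symm
    have hdU : glDiagonal 3 K d ∈ unitaryGroupOfForm σ J := by rw [hJ]; exact hdT.1
    have hu'U : u' ∈ unitaryGroupOfForm σ J := by rw [hJ]; exact hu'.1
    set dU : ↥(unitaryGroupOfForm σ J) := ⟨glDiagonal 3 K d, hdU⟩ with hdUdef
    set u'U : ↥(unitaryGroupOfForm σ J) := ⟨u', hu'U⟩ with hu'Udef
    have hdK : dU ∈ (congruenceGL 3 γ).comap (unitaryGroupOfForm σ J).subtype := by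
      rw [Subgroup.mem_comap]
      exact glDiagonal_mem_congruenceGL_of_apply_eq hγ (Subgroup.mem_comap.1 hb'K) d hdiag
    have hb'_eq : b' = u'U * dU := Subtype.ext hb'ud
    have hu'K : u'U ∈ (congruenceGL 3 γ).comap (unitaryGroupOfForm σ J).subtype := by
      have : u'U = b' * dU⁻¹ := by rw [hb'_eq, mul_inv_cancel_right]
      rw [this]
      exact Subgroup.mul_mem _ hb'K (Subgroup.inv_mem _ hdK)
    have hu'N : u'U ∈ (borelTriple σ J hJ).N := by
      rw [borelTriple_N]
      exact hu'.2
    -- `c = w₀ b' w₀ = (w₀ u' w₀)(w₀ diag(d) w₀)`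
    have hc_eq : cU = (weylLongU σ hJ * u'U * weylLongU σ hJ) * (weylLongU σ hJ * dU * weylLongU σ hJ) := by
      have : cU = weylLongU σ hJ * b' * weylLongU σ hJ := by
        rw [hb'def]
        simp only [← mul_assoc, hw1, one_mul]
        rw [mul_assoc, hw1, mul_one]
      rw [this, hb'_eq]
      simp only [mul_assoc, ← mul_assoc (weylLongU σ hJ) (weylLongU σ hJ), hw1, one_mul]
    -- assemble
    refine Set.mem_mul.2 ⟨(weylLongU σ hJ * u'U * weylLongU σ hJ) * (weylLongU σ hJ * dU * weylLongU σ hJ),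
      Set.mem_mul.2 ⟨weylLongU σ hJ * u'U * weylLongU σ hJ, ?_, weylLongU σ hJ * dU * weylLongU σ hJ, ?_, rfl⟩, uU⁻¹, ?_, ?_⟩
    · refine Subgroup.mem_inf.2 ⟨weylLongU_mul_mul_weylLongU_mem_comap_congruenceGL σ hJ hu'K, Subgroup.mem_map.2 ⟨u'U, hu'N, ?_⟩⟩
      rw [MulEquiv.coe_toMonoidHom, MulAut.conj_apply, hwinv]
    · refine Subgroup.mem_inf.2 ⟨weylLongU_mul_mul_weylLongU_mem_comap_congruenceGL σ hJ hdK, ?_⟩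
      rw [borelTriple_M, mem_torusU_iff]
      exact ⟨d ∘ Fin.rev, (coe_weylLongU_mul_mul_weylLongU_of_eq_glDiagonal σ hJ rfl).symm⟩
    · refine Subgroup.mem_inf.2 ⟨Subgroup.inv_mem _ ?_, Subgroup.inv_mem _ ?_⟩
      · rw [Subgroup.mem_comap, Subgroup.coe_subtype, hcoe_u]; exact huK
      · rw [borelTriple_N]
        show ((uU : ↥(unitaryGroupOfForm σ J)) : GL (Fin 3) K) ∈ upperUnitriangular (Fin 3) K
        rw [hcoe_u]; exact huN
    · rw [hk_eq, hc_eq]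
  · rintro _ ⟨_, ⟨x, hx, y, hy, rfl⟩, z, hz, rfl⟩
    exact Subgroup.mul_mem _ (Subgroup.mul_mem _ (Subgroup.mem_inf.1 hx).1 (Subgroup.mem_inf.1 hy).1) (Subgroup.mem_inf.1 hz).1

omit [ValuativeRel K] in
/-- **`w₀ N w₀` is lower triangular**: the matrix of an element of `N̄ = w₀ N w₀` lies in the opposite Borel `B⁻`. [cite: Rogawski1990, §1.10 p. 9] -/
theorem coe_mem_oppositeParabolicGL_of_mem_Nbar {x : ↥(unitaryGroupOfForm σ J)}
    (hx : x ∈ ((borelTriple σ J hJ).N).map (MulAut.conj (weylLongU σ hJ)).toMonoidHom) :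
    ((x : ↥(unitaryGroupOfForm σ J)) : GL (Fin 3) K) ∈ oppositeParabolicGL K (_root_.id : Fin 3 → Fin 3) := by
  obtain ⟨n, hn, hnx⟩ := Subgroup.mem_map.1 hx
  have hwinv : (weylLongU σ hJ)⁻¹ = weylLongU σ hJ := (eq_inv_of_mul_eq_one_left (weylLongU_mul_weylLongU σ hJ)).symm
  have hnx' : x = weylLongU σ hJ * n * weylLongU σ hJ := by rw [← hnx, MulEquiv.coe_toMonoidHom, MulAut.conj_apply, hwinv]
  rw [borelTriple_N] at hn
  have hup := ((mem_unipotentU_iff n).1 hn).1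
  rw [mem_oppositeParabolicGL_iff]
  intro i j hij
  rw [hnx', coe_weylLongU_mul_mul_weylLongU_apply]
  exact hup (by simpa [Fin.rev_lt_rev] using hij)

omit [ValuativeRel K] in
/-- A diagonal element of `U` has a lower-triangular (indeed diagonal) matrix. [cite: Rogawski1990, §1.10 p. 9] -/
theorem coe_mem_oppositeParabolicGL_of_mem_M {x : ↥(unitaryGroupOfForm σ J)} (hx : x ∈ (borelTriple σ J hJ).M) :
    ((x : ↥(unitaryGroupOfForm σ J)) : GL (Fin 3) K) ∈ oppositeParabolicGL K (_root_.id : Fin 3 → Fin 3) := by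
  rw [borelTriple_M, mem_torusU_iff] at hx
  obtain ⟨d, hd⟩ := hx
  rw [mem_oppositeParabolicGL_iff, ← hd, coe_glDiagonal]
  intro i j hij
  exact Matrix.diagonal_apply_ne _ (ne_of_lt hij)

omit [ValuativeRel K] in
/-- **Uniqueness of the `N`-component in `N̄ · T · N`** (B-p04's `hinj` binder of ★ `DoubleCosetShellVolumeBound`): if `n̄ m n = n̄' m' n'` with
`n̄, n̄' ∈ w₀Nw₀`, `m, m' ∈ T`, `n, n' ∈ N`, then `n = n'` (invert and apply ★ `unitriangular_mul_lower_unique`: an upper unitriangular matrix that is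
lower triangular is `1`). [cite: Casselman1995, Prop. 1.4.4] [cite: BruhatTits1972, (4.4.4)] -/
theorem nbar_mul_torus_mul_unipotent_inj :
    ∀ nb ∈ ((borelTriple σ J hJ).N).map (MulAut.conj (weylLongU σ hJ)).toMonoidHom, ∀ m ∈ (borelTriple σ J hJ).M,
      ∀ n ∈ (borelTriple σ J hJ).N, ∀ nb' ∈ ((borelTriple σ J hJ).N).map (MulAut.conj (weylLongU σ hJ)).toMonoidHom,
        ∀ m' ∈ (borelTriple σ J hJ).M, ∀ n' ∈ (borelTriple σ J hJ).N, nb * m * n = nb' * m' * n' → n = n' := by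
  intro nb hnb m hm n hn nb' hnb' m' hm' n' hn' h
  -- invert: `n⁻¹ (m⁻¹ n̄⁻¹) = n'⁻¹ (m'⁻¹ n̄'⁻¹)`, «unitriangular × lower»
  have h' : ((n⁻¹ : ↥(unitaryGroupOfForm σ J)) : GL (Fin 3) K) * ((m⁻¹ * nb⁻¹ : ↥(unitaryGroupOfForm σ J)) : GL (Fin 3) K) =
      ((n'⁻¹ : ↥(unitaryGroupOfForm σ J)) : GL (Fin 3) K) * ((m'⁻¹ * nb'⁻¹ : ↥(unitaryGroupOfForm σ J)) : GL (Fin 3) K) := by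
    have hinv := congrArg (fun g : ↥(unitaryGroupOfForm σ J) => ((g⁻¹ : ↥(unitaryGroupOfForm σ J)) : GL (Fin 3) K)) h
    simpa only [_root_.mul_inv_rev, Subgroup.coe_mul, mul_assoc] using hinv
  have hnN : ((n⁻¹ : ↥(unitaryGroupOfForm σ J)) : GL (Fin 3) K) ∈ upperUnitriangular (Fin 3) K := by
    have := (borelTriple σ J hJ).N.inv_mem hn; rw [borelTriple_N] at this; exact this
  have hn'N : ((n'⁻¹ : ↥(unitaryGroupOfForm σ J)) : GL (Fin 3) K) ∈ upperUnitriangular (Fin 3) K := by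
    have := (borelTriple σ J hJ).N.inv_mem hn'; rw [borelTriple_N] at this; exact this
  have hbB : ((m⁻¹ * nb⁻¹ : ↥(unitaryGroupOfForm σ J)) : GL (Fin 3) K) ∈ oppositeParabolicGL K (_root_.id : Fin 3 → Fin 3) := by
    rw [Subgroup.coe_mul]
    exact Subgroup.mul_mem _ (coe_mem_oppositeParabolicGL_of_mem_M σ hJ ((borelTriple σ J hJ).M.inv_mem hm))
      (coe_mem_oppositeParabolicGL_of_mem_Nbar σ hJ (Subgroup.inv_mem _ hnb))
  have hb'B : ((m'⁻¹ * nb'⁻¹ : ↥(unitaryGroupOfForm σ J)) : GL (Fin 3) K) ∈ oppositeParabolicGL K (_root_.id : Fin 3 → Fin 3) := by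
    rw [Subgroup.coe_mul]
    exact Subgroup.mul_mem _ (coe_mem_oppositeParabolicGL_of_mem_M σ hJ ((borelTriple σ J hJ).M.inv_mem hm'))
      (coe_mem_oppositeParabolicGL_of_mem_Nbar σ hJ (Subgroup.inv_mem _ hnb'))
  have huniq := (unitriangular_mul_lower_unique hnN hn'N hbB hb'B h').1
  have : n⁻¹ = n'⁻¹ := Subtype.ext huniq
  exact inv_injective this


end Alg

/-! ## §2 Over a non-archimedean local field: exhaustion, shrinking of `N̄`, the neighbourhood basis, the datum -/

section Top

variable {K : Type*} [Field K] [ValuativeRel K] [TopologicalSpace K] [IsNonarchimedeanLocalField K]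
  (σ : K →+* K) {J : Matrix (Fin 3) (Fin 3) K} (hJ : J = (StdForm.antidiagonal 3).over K)

/-- **Exhaustion of `N` by the ray, monotone form (R1's `hexh`)**: for `s = diag(u)` with ratios `≤ q < 1` (`q ≠ 0`) and any level `0 ≠ γ < 1`,
every `n ∈ N` has `s^{m'} n s^{-m'} ∈ K_γ` for all large `m'` (★ `exists_mem_rayLevel` + dominance of the powers).
[cite: BernsteinZelevinsky1977, §1.9] [cite: Casselman1995, proof of Thm. 5.3.1] -/
theorem exists_forall_pow_conj_mem {q : ValueGroupWithZero K} (hq0 : q ≠ 0) (hq1 : q < 1) {γ : ValueGroupWithZero K} (hγ0 : γ ≠ 0)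
    (hγ : γ < 1) (s : ↥(unitaryGroupOfForm σ J)) (u : Fin 3 → Kˣ) (hs : ((s : ↥(unitaryGroupOfForm σ J)) : GL (Fin 3) K) = glDiagonal 3 K u)
    (hu : ∀ i j : Fin 3, i < j → valuation K ((u i : K) * ((u j : K))⁻¹) ≤ q) {n : ↥(unitaryGroupOfForm σ J)}
    (hn : n ∈ (borelTriple σ J hJ).N) :
    ∃ m : ℕ, ∀ m' : ℕ, m ≤ m' → s ^ m' * n * (s ^ m')⁻¹ ∈ (congruenceGL 3 γ).comap (unitaryGroupOfForm σ J).subtype := by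
  obtain ⟨i, hi⟩ := exists_mem_rayLevel σ hJ hq0 hq1 hγ0 hγ s u hs hu hn
  rw [mem_map_conj_zpow_neg_iff] at hi
  -- `s^i n s^{-i} ∈ K_γ ∩ N` with `i : ℤ`; from `m := i.toNat` on, conjugates stay in `K_γ ∩ N`
  refine ⟨i.toNat, fun m' hm' => ?_⟩
  obtain ⟨k, hk⟩ : ∃ k : ℕ, k + i.toNat = m' := ⟨m' - i.toNat, Nat.sub_add_cancel hm'⟩
  by_cases hi0 : 0 ≤ i
  · -- `i ≥ 0`: `s^{m'} = s^{k} s^{i}`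
    have hzi : s ^ i = s ^ i.toNat := by
      conv_lhs => rw [← Int.toNat_of_nonneg hi0]
      exact zpow_natCast s i.toNat
    have hmem0 : s ^ i.toNat * n * (s ^ i.toNat)⁻¹ ∈
        (congruenceGL 3 γ).comap (unitaryGroupOfForm σ J).subtype ⊓ (borelTriple σ J hJ).N := by
      have : s ^ i * n * s ^ (-i) = s ^ i.toNat * n * (s ^ i.toNat)⁻¹ := by rw [_root_.zpow_neg, hzi]
      rwa [this] at hi
    have hmem := pow_conj_mem_of_mem_N σ hJ hγ hq1.le s u hs hu k hmem0
    have hre : s ^ k * (s ^ i.toNat * n * (s ^ i.toNat)⁻¹) * (s ^ k)⁻¹ = s ^ m' * n * (s ^ m')⁻¹ := by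
      rw [← hk, pow_add, _root_.mul_inv_rev]
      simp only [mul_assoc]
    rw [hre] at hmem
    exact (Subgroup.mem_inf.1 hmem).1
  · -- `i < 0`: `n` itself lies in `K_γ ∩ N`
    have hni : 0 ≤ -i := by omega
    have hzi : s ^ (-i) = s ^ (-i).toNat := by
      conv_lhs => rw [← Int.toNat_of_nonneg hni]
      exact zpow_natCast s (-i).toNat
    have hn' : n ∈ (congruenceGL 3 γ).comap (unitaryGroupOfForm σ J).subtype ⊓ (borelTriple σ J hJ).N := by
      have hre : n = s ^ (-i).toNat * (s ^ i * n * s ^ (-i)) * (s ^ (-i).toNat)⁻¹ := by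
        rw [← hzi, _root_.zpow_neg]
        group
      rw [hre]
      exact pow_conj_mem_of_mem_N σ hJ hγ hq1.le s u hs hu _ hi
    exact (Subgroup.mem_inf.1 (pow_conj_mem_of_mem_N σ hJ hγ hq1.le s u hs hu m' hn')).1

/-- **`s⁻ⁱ (K_γ ∩ N̄) sⁱ` becomes arbitrarily small** (the `exists_conj_inf_Nbar_le` axiom of ★ `IwahoriDatum`, in `ConjAct` form): for every target
level `γ' ≠ 0` some power has `(sⁱ)⁻¹ • (K_γ ∩ N̄) ≤ K_{γ'}`. [cite: Casselman1995, Prop. 1.4.3] -/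
theorem exists_pow_inv_conj_Nbar_le {q : ValueGroupWithZero K} (hq0 : q ≠ 0) (hq1 : q < 1) {γ γ' : ValueGroupWithZero K} (hγ : γ < 1)
    (hγ'0 : γ' ≠ 0) (s : ↥(unitaryGroupOfForm σ J)) (u : Fin 3 → Kˣ) (hs : ((s : ↥(unitaryGroupOfForm σ J)) : GL (Fin 3) K) = glDiagonal 3 K u)
    (hu : ∀ i j : Fin 3, i < j → valuation K ((u i : K) * ((u j : K))⁻¹) ≤ q) :
    ∃ i : ℕ, ConjAct.toConjAct (s ^ i)⁻¹ •
        ((congruenceGL 3 γ).comap (unitaryGroupOfForm σ J).subtype ⊓ ((borelTriple σ J hJ).N).map (MulAut.conj (weylLongU σ hJ)).toMonoidHom) ≤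
      (congruenceGL 3 γ').comap (unitaryGroupOfForm σ J).subtype := by
  obtain ⟨i, hi⟩ := exists_pow_mul_le hq0 hq1 γ hγ'0
  refine ⟨i, ?_⟩
  rintro _ ⟨x, hx, rfl⟩
  have hmem := pow_inv_conj_mem_of_mem_Nbar σ hJ hγ hq1.le s u hs hu i hx
  have h1 := (Subgroup.mem_inf.1 hmem).1
  rw [MulDistribMulAction.toMonoidEnd_apply, MulDistribMulAction.toMonoidHom_apply, ConjAct.smul_def, ConjAct.ofConjAct_toConjAct, inv_inv]
  exact Subgroup.mem_comap.2 (congruenceGL_mono hi (Subgroup.mem_comap.1 h1))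

/-- **The levels `K_{γ₀^{j+1}} ∩ U` form a neighbourhood basis of `1` in `U`** (`0 ≠ γ₀ < 1`; ★ `exists_congruenceGL_subset` in `GL₃(K)`, the subspace
topology, and `γ₀^{j+1} → 0`). [cite: Casselman1995, Prop. 1.4.4] -/
theorem exists_comap_congruenceGL_pow_subset {γ₀ : ValueGroupWithZero K} (hγ₀0 : γ₀ ≠ 0) (hγ₀1 : γ₀ < 1)
    {O : Set ↥(unitaryGroupOfForm σ J)} (hO : O ∈ 𝓝 (1 : ↥(unitaryGroupOfForm σ J))) :
    ∃ j : ℕ, (((congruenceGL 3 (γ₀ ^ (j + 1))).comap (unitaryGroupOfForm σ J).subtype : Subgroup ↥(unitaryGroupOfForm σ J)) :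
      Set ↥(unitaryGroupOfForm σ J)) ⊆ O := by
  obtain ⟨O', hO', hsub⟩ := (mem_nhds_induced Subtype.val (1 : ↥(unitaryGroupOfForm σ J)) O).1 hO
  rw [Subgroup.coe_one] at hO'
  obtain ⟨δ, hδ⟩ := exists_congruenceGL_subset hO'
  obtain ⟨j, hj⟩ := exists_pow_mul_le hγ₀0 hγ₀1 γ₀ (Units.ne_zero δ)
  refine ⟨j, fun y hy => hsub ?_⟩
  show ((y : ↥(unitaryGroupOfForm σ J)) : GL (Fin 3) K) ∈ O'
  refine hδ (congruenceGL_mono ?_ (Subgroup.mem_comap.1 hy))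
  calc γ₀ ^ (j + 1) = γ₀ ^ j * γ₀ := pow_succ γ₀ j
    _ ≤ (δ : ValueGroupWithZero K) := hj

/-- **THE IWAHORI DATUM OF THE BOREL OF `U(σ, Φ₃)(K)` ALONG A DIAGONAL RAY** (`σ` continuous; levels `K_j = K_{γ₀^{j+1}} ∩ U` with `0 ≠ γ₀ < 1`;
opposite radical `N̄ = w₀ N w₀`; ray `s = diag(u) ∈ U` with `|u_i/u_j| ≤ q` for `i < j`, `0 ≠ q < 1` — e.g. `d(ϖ, 1, (σϖ)⁻¹)`, ★
`exists_coe_eq_diagonal_uniformizer`).  The input of ★ Jacquet's lemma (`JacquetLemma`), ★ R2 `range_fixedPointsMk_eq`, ★ R2b.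
[cite: Casselman1995, Prop. 1.4.4] [cite: BernsteinZelevinsky1976, §3.13] [cite: BruhatTits1972, (4.4.3)–(4.4.4)] -/
noncomputable def iwahoriDatumU3 (hσc : Continuous σ) {γ₀ : ValueGroupWithZero K} (hγ₀0 : γ₀ ≠ 0) (hγ₀1 : γ₀ < 1)
    {q : ValueGroupWithZero K} (hq0 : q ≠ 0) (hq1 : q < 1) (s : ↥(unitaryGroupOfForm σ J)) (u : Fin 3 → Kˣ)
    (hs : ((s : ↥(unitaryGroupOfForm σ J)) : GL (Fin 3) K) = glDiagonal 3 K u)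
    (hu : ∀ i j : Fin 3, i < j → valuation K ((u i : K) * ((u j : K))⁻¹) ≤ q) : (borelTriple σ J hJ).IwahoriDatum where
  Nbar := ((borelTriple σ J hJ).N).map (MulAut.conj (weylLongU σ hJ)).toMonoidHom
  a := s
  a_mem := by rw [borelTriple_M, mem_torusU_iff]; exact ⟨u, hs.symm⟩
  a_comm := fun m hm => by
    rw [borelTriple_M] at hm
    have h := torusU_mul_comm σ J ⟨m, hm⟩ ⟨s, by rw [mem_torusU_iff]; exact ⟨u, hs.symm⟩⟩
    exact congrArg Subtype.val h
  K := fun j => (congruenceGL 3 (γ₀ ^ (j + 1))).comap (unitaryGroupOfForm σ J).subtype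
  isOpen_K := fun j => (isCompact_isOpen_comap_congruenceGL σ (J := J) hσc (pow_ne_zero _ hγ₀0)).2
  isCompact_K := fun j => (isCompact_isOpen_comap_congruenceGL σ (J := J) hσc (pow_ne_zero _ hγ₀0)).1
  hasBasis_K := fun O hO => exists_comap_congruenceGL_pow_subset σ hγ₀0 hγ₀1 hO
  factorization := fun j => coe_comap_congruenceGL_eq_mul σ hJ (pow_lt_one₀ zero_le hγ₀1 (Nat.succ_ne_zero j))
  exists_conj_inf_Nbar_le := fun n j =>
    exists_pow_inv_conj_Nbar_le σ hJ hq0 hq1 (pow_lt_one₀ zero_le hγ₀1 (Nat.succ_ne_zero n)) (pow_ne_zero _ hγ₀0) s u hs hu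

/-- The levels of `iwahoriDatumU3`. [cite: Casselman1995, Prop. 1.4.4] -/
theorem iwahoriDatumU3_K (hσc : Continuous σ) {γ₀ : ValueGroupWithZero K} (hγ₀0 : γ₀ ≠ 0) (hγ₀1 : γ₀ < 1)
    {q : ValueGroupWithZero K} (hq0 : q ≠ 0) (hq1 : q < 1) (s : ↥(unitaryGroupOfForm σ J)) (u : Fin 3 → Kˣ)
    (hs : ((s : ↥(unitaryGroupOfForm σ J)) : GL (Fin 3) K) = glDiagonal 3 K u)
    (hu : ∀ i j : Fin 3, i < j → valuation K ((u i : K) * ((u j : K))⁻¹) ≤ q) (j : ℕ) :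
    (iwahoriDatumU3 σ hJ hσc hγ₀0 hγ₀1 hq0 hq1 s u hs hu).K j = (congruenceGL 3 (γ₀ ^ (j + 1))).comap (unitaryGroupOfForm σ J).subtype := rfl

/-- The ray of `iwahoriDatumU3`. [cite: Casselman1995, Prop. 1.4.4] -/
theorem iwahoriDatumU3_a (hσc : Continuous σ) {γ₀ : ValueGroupWithZero K} (hγ₀0 : γ₀ ≠ 0) (hγ₀1 : γ₀ < 1)
    {q : ValueGroupWithZero K} (hq0 : q ≠ 0) (hq1 : q < 1) (s : ↥(unitaryGroupOfForm σ J)) (u : Fin 3 → Kˣ)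
    (hs : ((s : ↥(unitaryGroupOfForm σ J)) : GL (Fin 3) K) = glDiagonal 3 K u)
    (hu : ∀ i j : Fin 3, i < j → valuation K ((u i : K) * ((u j : K))⁻¹) ≤ q) :
    (iwahoriDatumU3 σ hJ hσc hγ₀0 hγ₀1 hq0 hq1 s u hs hu).a = s := rfl

/-- The opposite radical of `iwahoriDatumU3` is `w₀ N w₀`. [cite: Casselman1995, Prop. 1.4.4] -/
theorem iwahoriDatumU3_Nbar (hσc : Continuous σ) {γ₀ : ValueGroupWithZero K} (hγ₀0 : γ₀ ≠ 0) (hγ₀1 : γ₀ < 1)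
    {q : ValueGroupWithZero K} (hq0 : q ≠ 0) (hq1 : q < 1) (s : ↥(unitaryGroupOfForm σ J)) (u : Fin 3 → Kˣ)
    (hs : ((s : ↥(unitaryGroupOfForm σ J)) : GL (Fin 3) K) = glDiagonal 3 K u)
    (hu : ∀ i j : Fin 3, i < j → valuation K ((u i : K) * ((u j : K))⁻¹) ≤ q) :
    (iwahoriDatumU3 σ hJ hσc hγ₀0 hγ₀1 hq0 hq1 s u hs hu).Nbar =
      ((borelTriple σ J hJ).N).map (MulAut.conj (weylLongU σ hJ)).toMonoidHom := rfl

/-- **R1∕R4's dominance hypotheses for the datum, packaged**: for every level `j`, `s (K_j ∩ N) s⁻¹ ⊆ K_j` (`haN`),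
`s⁻¹ (K_j ∩ N̄) s ⊆ K_j ∩ N̄` (`haNbar`), every `n ∈ N` is eventually conjugated into `K_j` (`hexh`), and `K_j` is normalised by `K₀ = U ∩ GL₃(𝒪)`
(`hKK₀`). [cite: Casselman1995, Prop. 1.4.3, Prop. 1.4.4] -/
theorem iwahoriDatumU3_dominant (hσc : Continuous σ) {γ₀ : ValueGroupWithZero K} (hγ₀0 : γ₀ ≠ 0) (hγ₀1 : γ₀ < 1)
    {q : ValueGroupWithZero K} (hq0 : q ≠ 0) (hq1 : q < 1) (s : ↥(unitaryGroupOfForm σ J)) (u : Fin 3 → Kˣ)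
    (hs : ((s : ↥(unitaryGroupOfForm σ J)) : GL (Fin 3) K) = glDiagonal 3 K u)
    (hu : ∀ i j : Fin 3, i < j → valuation K ((u i : K) * ((u j : K))⁻¹) ≤ q) (j : ℕ) :
    (∀ x ∈ (iwahoriDatumU3 σ hJ hσc hγ₀0 hγ₀1 hq0 hq1 s u hs hu).K j ⊓ (borelTriple σ J hJ).N,
        s * x * s⁻¹ ∈ (iwahoriDatumU3 σ hJ hσc hγ₀0 hγ₀1 hq0 hq1 s u hs hu).K j) ∧
    (∀ x ∈ (iwahoriDatumU3 σ hJ hσc hγ₀0 hγ₀1 hq0 hq1 s u hs hu).K j ⊓ (iwahoriDatumU3 σ hJ hσc hγ₀0 hγ₀1 hq0 hq1 s u hs hu).Nbar,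
        s⁻¹ * x * s ∈ (iwahoriDatumU3 σ hJ hσc hγ₀0 hγ₀1 hq0 hq1 s u hs hu).K j ⊓ (iwahoriDatumU3 σ hJ hσc hγ₀0 hγ₀1 hq0 hq1 s u hs hu).Nbar) ∧
    (∀ n ∈ (borelTriple σ J hJ).N, ∃ m : ℕ, ∀ m' : ℕ, m ≤ m' →
        s ^ m' * n * (s ^ m')⁻¹ ∈ (iwahoriDatumU3 σ hJ hσc hγ₀0 hγ₀1 hq0 hq1 s u hs hu).K j) ∧
    (∀ k ∈ (glInt 3 K).comap (unitaryGroupOfForm σ J).subtype, ∀ κ ∈ (iwahoriDatumU3 σ hJ hσc hγ₀0 hγ₀1 hq0 hq1 s u hs hu).K j,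
        k⁻¹ * κ * k ∈ (iwahoriDatumU3 σ hJ hσc hγ₀0 hγ₀1 hq0 hq1 s u hs hu).K j) := by
  have hγ : γ₀ ^ (j + 1) < 1 := pow_lt_one₀ zero_le hγ₀1 (Nat.succ_ne_zero j)
  refine ⟨fun x hx => conj_mem_comap_congruenceGL_of_mem_N σ hJ hγ hq1.le s u hs hu hx, fun x hx => ?_,
    fun n hn => exists_forall_pow_conj_mem σ hJ hq0 hq1 (pow_ne_zero _ hγ₀0) hγ s u hs hu hn,
    fun k hk κ hκ => inv_mul_mul_mem_comap_congruenceGL_of_mem_glInt σ hk hκ⟩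
  have h := inv_conj_mem_of_mem_Nbar σ hJ hγ ((mul_le_mul' hq1.le le_rfl).trans (one_mul _).le) s u hs hu hx
  exact h

end Top

end UnitaryGroup

end Literature.NumberTheory.Automorphic
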